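import Summits.QuantumAdvantage.AdviceFreeQNC0.AffBells22FibreSumJunta
import HarnessLib

/-!
# Cell qa-qnc0, `p = 3` — JUNTA PRODUCTS OF BOUNDED OUTSIDE SIZE versus an `𝔽₃`-character: the degree (Viola–Wigderson /
# Green–Roy–Straubing) replacement of LEMMA JPD (prover qn-prover-3 g25)

LEMMA JPD (`AffBells23.norm_sum_juntaProduct_mul_char_le`, planner p1 g23) bounds `‖Σ_v Ψ₀(v)·Π_k h_k(v)·ω^{Σ_i [v_i]γ_i}‖` by
`Π_i (i ∈ A ∧ γ_i ≠ 0 ? √3 : 2)` for a TRANSVERSAL `A` of the reading sets `S_k` of the `±1`-juntas `h_k` — it sees one twisted letter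
per junta.  When the juntas OVERLAP densely no large transversal exists; but if every `S_k` has at most `w` letters outside a set `W`
then, for every assignment of the `W`-coordinates, `Ψ₀·Π_k h_k` is `(−1)^{Q}` with `Q` an `𝔽₂`-polynomial of degree `≤ max w 1` in the
remaining coordinates (`TwoModuli.mem_degLE_card_of_forall_eq`), and the tree's Viola–Wigderson/GRS estimate for an ARBITRARY linear
form modulo `3` (`TwoModuli.norm_sum_mul_stdAddChar_linear_le`, `Literature/…/ModmVersusF2Polynomials`) gives

* **`AffBells23.norm_sum_juntaProduct_mul_char_le_of_size`**:
  `‖Σ_v Ψ₀(v)·Π_{k∈s} h_k(v)·χ₃(Σ_i [v_i]γ_i)‖ ≤ 2^{|ι|} · exp(−3·#{i ∉ W : γ_i ≠ 0} / (8·4^{max w 1}))`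
  — arbitrary overlaps and multiplicities of the `S_k`, decay in EVERY twisted letter outside `W`.

This is the cube-level input of `R1JuntaSize39.lean` ((R1) for scattered juntas of bounded size with arbitrary overlaps).

WHAT THIS IS NOT: no cell statement here; the rate `exp(−3/(8·4^w))` per letter is Viola–Wigderson's and is useless for `w ≳ log₂`
of the number of twisted letters (the polylog-junta regime of (R1) stays open).
-/

noncomputable section

namespace Summit.QuantumAdvantage.AdviceFreeQNC0

open Finset
open Literature.Computability.MetaComplexity Literature.Computability.MetaComplexity.TwoModuli

namespace AffBells23

variable {ι : Type*} [Fintype ι] [DecidableEq ι]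

/-- An additive character turns sums into products (private copy; the tree has several file-local copies). -/
private theorem addChar_map_sum_eq_prod {A M : Type*} [AddCommMonoid A] [CommMonoid M] (ψ : AddChar A M)
    {κ : Type*} (s : Finset κ) (f : κ → A) : ψ (∑ i ∈ s, f i) = ∏ i ∈ s, ψ (f i) := by
  classical
  induction s using Finset.induction_on with
  | empty => simp
  | insert j s hj ih => rw [sum_insert hj, prod_insert hj, AddChar.map_add_eq_mul, ih]

/-- `χ₂` of an indicator bit is the corresponding sign. -/
theorem stdAddChar_indicator (P : Prop) [Decidable P] :
    (ZMod.stdAddChar (if P then (1 : ZMod 2) else 0) : ℂ) = if P then (-1 : ℂ) else 1 := by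
  by_cases h : P
  · rw [if_pos h, if_pos h, AffBells22.stdAddChar_one_zmod_two]
  · rw [if_neg h, if_neg h, AddChar.map_zero_eq_one]

/-- A sign `u ∈ {±1}` is `χ₂` of its bit `[u = −1]`. -/
theorem sign_eq_stdAddChar_bit {u : ℂ} (hu : u = 1 ∨ u = -1) :
    u = (ZMod.stdAddChar (if u = -1 then (1 : ZMod 2) else 0) : ℂ) := by
  rw [stdAddChar_indicator]
  rcases hu with rfl | rfl
  · rw [if_neg (by norm_num)]
  · rw [if_pos rfl]

/-- The linear form splits along `I`: `Σ_i [glue_i]γ_i = Σ_{j ∈ I} [w_j]γ_j + Σ_{j ∉ I} [v_j]γ_j`. -/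
theorem linform_glue (I : Finset ι) (γ : ι → ZMod 3) (w : {i // i ∈ I} → Bool) (v : {i // i ∉ I} → Bool) :
    (∑ i : ι, if glue I w v i then γ i else 0)
      = (∑ j : {i // i ∈ I}, if w j then γ j else 0) + (∑ j : {i // i ∉ I}, if v j then γ j else 0) := by
  have e1 : (∑ j : {i // i ∈ I}, if w j then γ j else 0) = ∑ j : {i // i ∈ I}, if glue I w v j then γ j else 0 :=
    sum_congr rfl fun j _ => by rw [glue_apply_mem _ _ j.2]
  have e2 : (∑ j : {i // i ∉ I}, if v j then γ j else 0) = ∑ j : {i // i ∉ I}, if glue I w v j then γ j else 0 :=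
    sum_congr rfl fun j _ => by rw [glue_apply_not_mem _ _ j.2]
  rw [e1, e2, ← Finset.sum_subtype I (fun _ => Iff.rfl) (f := fun i => if glue I w v i then γ i else 0),
    ← Finset.sum_subtype (p := fun i => i ∉ I) Iᶜ (fun _ => Finset.mem_compl)
      (f := fun i => if glue I w v i then γ i else 0),
    Finset.sum_add_sum_compl]

/-- The two parts of a split cube have complementary sizes: `#{i ∈ I} + #{i ∉ I} = |ι|`. -/
theorem card_subtype_add_card_subtype_not (I : Finset ι) :
    Fintype.card {i // i ∈ I} + Fintype.card {i // i ∉ I} = Fintype.card ι := by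
  rw [Fintype.card_subtype, Fintype.card_subtype, Finset.card_filter_add_card_filter_not, Finset.card_univ]

/-- **JUNTA PRODUCTS OF BOUNDED OUTSIDE SIZE versus an `𝔽₃`-character.**  `h_k` (`k ∈ s`) `±1`-valued juntas reading `S_k` with
`#(S_k ∖ W) ≤ w`, `Ψ₀` a `±1`-coordinate product, `γ` any frequency: `‖Σ_v Ψ₀(v)·Π_k h_k(v)·χ₃(Σ_i [v_i]γ_i)‖ ≤
2^{|ι|}·exp(−3·#{i ∉ W : γ_i ≠ 0}/(8·4^{max w 1}))`.  (Fix the `W`-coordinates; on the rest the sign is `(−1)^Q`, `deg Q ≤ max w 1`;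
Viola–Wigderson for an arbitrary linear form, `TwoModuli.norm_sum_mul_stdAddChar_linear_le`.) -/
theorem norm_sum_juntaProduct_mul_char_le_of_size {κ : Type*} (s : Finset κ) (S : κ → Finset ι) (h : κ → (ι → Bool) → ℂ)
    (hpm : ∀ k ∈ s, ∀ v, h k v = 1 ∨ h k v = -1) (hread : ∀ k ∈ s, ReadsOn (S k) (h k))
    {Ψ₀ : (ι → Bool) → ℂ} (hΨ₀ : AffBells22.IsCoordProduct Ψ₀) (γ : ι → ZMod 3) (W : Finset ι) {w : ℕ}
    (hS : ∀ k ∈ s, (S k \ W).card ≤ w) :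
    ‖∑ v : ι → Bool, Ψ₀ v * (∏ k ∈ s, h k v) * (ZMod.stdAddChar (∑ i, if v i then γ i else 0) : ℂ)‖
      ≤ (2 : ℝ) ^ Fintype.card ι *
          Real.exp (-(3 * ((univ.filter fun i : ι => i ∉ W ∧ γ i ≠ 0).card : ℝ) / (8 * 4 ^ (max w 1)))) := by
  classical
  obtain ⟨c, hc, g, hg, e⟩ := hΨ₀
  set I : Finset ι := univ.filter (fun i => i ∉ W) with hIdef
  have hmemI : ∀ i, i ∈ I ↔ i ∉ W := fun i => by simp [hIdef]
  set d := max w 1 with hd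
  -- split the cube along `I`
  rw [sum_eq_sum_sum_glue I]
  -- the inner sums
  have hinner : ∀ v : {i // i ∉ I} → Bool,
      ‖∑ x : {i // i ∈ I} → Bool, Ψ₀ (glue I x v) * (∏ k ∈ s, h k (glue I x v)) *
          (ZMod.stdAddChar (∑ i, if glue I x v i then γ i else 0) : ℂ)‖
        ≤ (2 : ℝ) ^ Fintype.card {i // i ∈ I} *
            Real.exp (-(3 * ((univ.filter fun i : ι => i ∉ W ∧ γ i ≠ 0).card : ℝ) / (8 * 4 ^ d))) := by
    intro v
    -- the sign as `χ₂(Q x)` with `Q` of degree `≤ d` in `x`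
    set qc : ({i // i ∈ I} → Bool) → ZMod 2 := fun _ => if c = -1 then 1 else 0 with hqc
    set qa : ι → ({i // i ∈ I} → Bool) → ZMod 2 := fun i x => if g i (glue I x v i) = -1 then 1 else 0 with hqa
    set qk : κ → ({i // i ∈ I} → Bool) → ZMod 2 := fun k x => if h k (glue I x v) = -1 then 1 else 0 with hqk
    set Q : ({i // i ∈ I} → Bool) → ZMod 2 := fun x => qc x + (∑ i : ι, qa i x) + ∑ k ∈ s, qk k x with hQ
    have hQdeg : Q ∈ degLE (ZMod 2) {i // i ∈ I} d := by
      have h0 : qc ∈ degLE (ZMod 2) {i // i ∈ I} d := by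
        refine degLE_mono (Nat.zero_le _) (mem_degLE_card_of_forall_eq (∅ : Finset {i // i ∈ I}) ?_)
        intro x y _; rfl
      have h1 : (∑ i : ι, qa i) ∈ degLE (ZMod 2) {i // i ∈ I} d := by
        refine Submodule.sum_mem _ fun i _ => degLE_mono (le_max_right w 1) ?_
        by_cases hi : i ∈ I
        · have hT : ({⟨i, hi⟩} : Finset {i // i ∈ I}).card ≤ 1 := by simp
          refine degLE_mono hT (mem_degLE_card_of_forall_eq _ ?_)
          intro x y hxy
          have hxi : x ⟨i, hi⟩ = y ⟨i, hi⟩ := hxy _ (mem_singleton_self _)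
          simp only [hqa, glue_apply_mem _ _ hi, hxi]
        · refine degLE_mono (Nat.zero_le 1) (mem_degLE_card_of_forall_eq (∅ : Finset {i // i ∈ I}) ?_)
          intro x y _
          simp only [hqa, glue_apply_not_mem _ _ hi]
      have h2 : (∑ k ∈ s, qk k) ∈ degLE (ZMod 2) {i // i ∈ I} d := by
        refine Submodule.sum_mem _ fun k hk => degLE_mono (le_max_left w 1) ?_
        have hT : ((S k).subtype fun i => i ∈ I).card ≤ w := by
          rw [card_subtype]
          have : (S k).filter (fun i => i ∈ I) = S k \ W := by
            ext i; simp [hmemI, mem_sdiff]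
          rw [this]; exact hS k hk
        refine degLE_mono hT (mem_degLE_card_of_forall_eq _ ?_)
        intro x y hxy
        have hglue : ∀ i ∈ S k, glue I x v i = glue I y v i := by
          intro i hi
          by_cases hiI : i ∈ I
          · rw [glue_apply_mem _ _ hiI, glue_apply_mem _ _ hiI]
            exact hxy ⟨i, hiI⟩ (mem_subtype.mpr hi)
          · rw [glue_apply_not_mem _ _ hiI, glue_apply_not_mem _ _ hiI]
        simp only [hqk, hread k hk _ _ hglue]
      have hsum : Q = qc + (∑ i : ι, qa i) + ∑ k ∈ s, qk k := by
        funext x; simp only [hQ, Pi.add_apply, Finset.sum_apply]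
      rw [hsum]
      exact Submodule.add_mem _ (Submodule.add_mem _ h0 h1) h2
    -- `χ₂(Q x)` is the sign
    have hsign : ∀ x : {i // i ∈ I} → Bool,
        (ZMod.stdAddChar (Q x) : ℂ) = Ψ₀ (glue I x v) * ∏ k ∈ s, h k (glue I x v) := by
      intro x
      simp only [hQ]
      rw [AddChar.map_add_eq_mul, AddChar.map_add_eq_mul, addChar_map_sum_eq_prod, addChar_map_sum_eq_prod, e]
      have ec : (ZMod.stdAddChar (qc x) : ℂ) = c := by
        simp only [hqc]; exact (sign_eq_stdAddChar_bit hc).symm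
      have ea : ∀ i, (ZMod.stdAddChar (qa i x) : ℂ) = g i (glue I x v i) := by
        intro i; simp only [hqa]; exact (sign_eq_stdAddChar_bit (hg i _)).symm
      have ek : ∀ k ∈ s, (ZMod.stdAddChar (qk k x) : ℂ) = h k (glue I x v) := by
        intro k hk; simp only [hqk]; exact (sign_eq_stdAddChar_bit (hpm k hk _)).symm
      rw [ec, Finset.prod_congr rfl fun i _ => ea i, Finset.prod_congr rfl fun k hk => ek k hk]
    -- the character splits; the `v`-part is a unimodular constant
    set cv : ℂ := (ZMod.stdAddChar (∑ j : {i // i ∉ I}, if v j then γ j else 0) : ℂ) with hcv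
    set γI : {i // i ∈ I} → ZMod 3 := fun j => γ j with hγI
    have hterm : ∀ x : {i // i ∈ I} → Bool,
        Ψ₀ (glue I x v) * (∏ k ∈ s, h k (glue I x v)) * (ZMod.stdAddChar (∑ i, if glue I x v i then γ i else 0) : ℂ)
          = cv * ((ZMod.stdAddChar (Q x) : ℂ) * (ZMod.stdAddChar (∑ j, if x j then γI j else 0) : ℂ)) := by
      intro x
      rw [hsign x, linform_glue, AddChar.map_add_eq_mul]
      simp only [hcv, hγI]
      ring
    rw [sum_congr rfl fun x _ => hterm x, ← mul_sum, norm_mul]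
    have hcvn : ‖cv‖ = 1 := AffBells21.norm_stdAddChar_three _
    rw [hcvn, one_mul]
    have hVW := norm_sum_mul_stdAddChar_linear_le hQdeg γI
    have hwt : (univ.filter fun j : {i // i ∈ I} => γI j ≠ 0).card = (univ.filter fun i : ι => i ∉ W ∧ γ i ≠ 0).card := by
      have e1 : (univ.filter fun j : {i // i ∈ I} => γI j ≠ 0) = ((univ.filter fun i : ι => i ∉ W ∧ γ i ≠ 0)).subtype (· ∈ I) := by
        ext j
        simp only [mem_filter, mem_univ, true_and, mem_subtype, hγI]
        constructor
        · intro hj; exact ⟨(hmemI j).mp j.2, hj⟩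
        · intro hj; exact hj.2
      rw [e1, card_subtype]
      congr 1
      ext i
      simp only [mem_filter, mem_univ, true_and, hmemI]
      tauto
    rw [hwt] at hVW
    exact hVW
  -- sum over the `W`-coordinates
  calc ‖∑ v : {i // i ∉ I} → Bool, ∑ x : {i // i ∈ I} → Bool, Ψ₀ (glue I x v) * (∏ k ∈ s, h k (glue I x v)) *
          (ZMod.stdAddChar (∑ i, if glue I x v i then γ i else 0) : ℂ)‖
      ≤ ∑ v : {i // i ∉ I} → Bool, ‖∑ x : {i // i ∈ I} → Bool, Ψ₀ (glue I x v) * (∏ k ∈ s, h k (glue I x v)) *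
          (ZMod.stdAddChar (∑ i, if glue I x v i then γ i else 0) : ℂ)‖ := norm_sum_le _ _
    _ ≤ ∑ _v : {i // i ∉ I} → Bool, (2 : ℝ) ^ Fintype.card {i // i ∈ I} *
          Real.exp (-(3 * ((univ.filter fun i : ι => i ∉ W ∧ γ i ≠ 0).card : ℝ) / (8 * 4 ^ d))) :=
        sum_le_sum fun v _ => hinner v
    _ = (2 : ℝ) ^ Fintype.card ι *
          Real.exp (-(3 * ((univ.filter fun i : ι => i ∉ W ∧ γ i ≠ 0).card : ℝ) / (8 * 4 ^ d))) := by
        rw [sum_const, card_univ, Fintype.card_fun, Fintype.card_bool, nsmul_eq_mul, ← mul_assoc]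
        congr 1
        push_cast
        rw [← pow_add, add_comm, card_subtype_add_card_subtype_not]

end AffBells23

end Summit.QuantumAdvantage.AdviceFreeQNC0

end
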